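import Mathlib
import Summits.ValiantsHypothesis.ValiantsHypothesis.Theses.GaugeDescent
import Summits.ValiantsHypothesis.ValiantsHypothesis.Theorems.GaugeDescentTorusOrbitDescentTorus
import Summits.ValiantsHypothesis.ValiantsHypothesis.Theorems.GaugeDescentTorusOrbitDescentGalois
import HarnessLib

/-!
# Route GaugeDescent — `TorusOrbitDescent` (stmt-ValiantsHypothesis-6635): Hilbert-90 descent for
# split diagonal tori

`TorusOrbitDescent` (support, card Lemma D(i)+(iii)): if the common zero set `R ⊂ ℂ^m` of a set `S`
of rational polynomials is the union of the `T = (ℂˣ)^k`-orbits (diagonal action through an integer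
weight matrix `A`) of `N ≥ 1` points, then `R` has a point with all coordinates in a number field
`K ⊂ ℂ` of degree `[K:ℚ] ≤ N`.

Proof (the planner's sketch, made kernel-checkable; helper files
`GaugeDescentTorusOrbitDescentTorus.lean` = the algebra of split tori,
`GaugeDescentTorusOrbitDescentGalois.lean` = class functions and the Galois set-up):
1. `R ≠ ∅` has an algebraic point `z` (Zariski's lemma), lying in a finite Galois extension `E/ℚ`
   inside `ℂ`; `z` is in the orbit of some `pts i₀`.
2. `G = Gal(E/ℚ)` acts on the CLASS FUNCTIONS of `E`-points (zero pattern + values of the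
   kernel-lattice monomials); Galois conjugates of `z` lie in `R`, points of `R` have one of the
   `≤ N` class functions of `pts 0, …, pts (N-1)` (same orbit ⇒ same class function), so the
   `G`-orbit of the class function `c` of `z` has `≤ N` elements and its stabiliser `H` has index
   `≤ N`; the fixed field `K₀ = E^H` has `[K₀:ℚ] = [G:H] ≤ N`, and every kernel-lattice monomial
   `z^u` (a value of `c`) is fixed by `H`, i.e. lies in `K₀`.
3. By `exists_point_over_of_invariants` (unimodular-completion-free form: retraction onto the
   kernel lattice + divisibility of `ℂˣ`) the orbit `T·z ⊆ R` contains a point `y` with all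
   non-zero coordinates in `K₀` (and zeros where `z` has zeros); `y ∈ T·z = T·pts i₀ ⊆ R`.

Honest framing: a reusable Galois-descent lemma for a conditional route (GaugeDescent:
GeomRigidity → … → PrimeFieldTransfer); `VP ≠ VNP` is NOT proved and nothing here is progress on it.

## References

* G. Berhuy, *An Introduction to Galois Cohomology and its Applications* (2010), Prop. III.8.24
  (Hilbert 90) and Thm. III.8.15 (descent lemma). [cite: Berhuy2010, Thm. III.8.15]
-/

set_option linter.dupNamespace false

noncomputable section

namespace Summit.ValiantsHypothesis.ValiantsHypothesis.Theorems.GaugeDescent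

open Finset MvPolynomial

/-- The torus action is multiplicative in `t`: `∏_l (t_l t'_l)^{A l v} = (∏_l t_l^{A l v}) (∏_l t'_l^{A l v})`.
[folklore] -/
theorem prod_mul_zpow_weights {k m : ℕ} (A : Fin k → Fin m → ℤ) (t t' : Fin k → ℂˣ) (v : Fin m) :
    (∏ l, (t l * t' l) ^ A l v) = (∏ l, t l ^ A l v) * ∏ l, t' l ^ A l v := by
  rw [← prod_mul_distrib]
  exact prod_congr rfl fun l _ => mul_zpow _ _ _

/-- **`TorusOrbitDescent` (stmt-ValiantsHypothesis-6635) — Hilbert-90 descent for split diagonal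
tori.** If `R = V(S) ⊂ ℂ^m` (`S ⊂ ℚ[x]`) is the union of the `(ℂˣ)^k`-orbits (weights `A`) of
`N ≥ 1` points, then `R` has a point over a number field `K ⊂ ℂ` with `[K:ℚ] ≤ N`: algebraic point
(Zariski) in a finite Galois `E/ℚ`; `Gal(E/ℚ)` permutes the `≤ N` class functions of points of `R`,
so the stabiliser `H` of the class function of `z` has index `≤ N` and the kernel-lattice monomials
`z^u` lie in `K₀ = E^H`, `[K₀:ℚ] ≤ N`; then `T·z` has a `K₀`-point (retraction onto `ker A` +
divisibility of `ℂˣ`, `exists_point_over_of_invariants`). [cite: Berhuy2010, Thm. III.8.15] -/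
theorem torusOrbitDescent_proof :
    Summit.ValiantsHypothesis.ValiantsHypothesis.Theses.GaugeDescent.TorusOrbitDescent := by
  intro m k N S A pts H1 H2 hN
  classical
  -- Step 0: the orbit representatives lie in `R`
  have hpt : ∀ i : Fin N, ∀ f ∈ S, aeval (pts i) f = 0 := by
    intro i f hf
    have := H1 i 1 f hf
    simpa using this
  -- Step 1: an algebraic point of `R`, inside a finite Galois extension `E/ℚ`
  obtain ⟨z, hzalg, hzR⟩ := exists_algebraic_zero S (pts ⟨0, hN⟩) (hpt _)
  obtain ⟨E, hEfd, hEgal, hzE⟩ := exists_galois_intermediateField z hzalg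
  let zE : Fin m → E := fun v => ⟨z v, hzE v⟩
  have hzE0 : ∀ v, zE v = 0 ↔ z v = 0 := fun v => by
    rw [← ZeroMemClass.coe_eq_zero]
  -- aeval through `E`
  have haevalE : ∀ (ψ : E →ₐ[ℚ] ℂ) (f : MvPolynomial (Fin m) ℚ),
      aeval (fun v => ψ (zE v)) f = ψ (aeval zE f) := fun ψ f => by
    rw [MvPolynomial.comp_aeval_apply]
  have hzER : ∀ f ∈ S, aeval zE f = 0 := by
    intro f hf
    have h := haevalE (IntermediateField.val E) f
    have h' : aeval (fun v => (IntermediateField.val E) (zE v)) f = aeval z f := rfl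
    have h2 : (((aeval zE f : E)) : ℂ) = 0 := h.symm.trans (h'.trans (hzR f hf))
    exact ZeroMemClass.coe_eq_zero.mp h2
  -- every Galois conjugate of `z` lies in `R`
  have hconjR : ∀ σ : E ≃ₐ[ℚ] E, ∀ f ∈ S, aeval (fun v => ((σ (zE v) : E) : ℂ)) f = 0 := by
    intro σ f hf
    have h := haevalE ((IntermediateField.val E).comp (σ : E →ₐ[ℚ] E)) f
    rw [hzER f hf, map_zero] at h
    exact h
  -- Step 2: the class function of `z` and its stabiliser
  let c : Fin m ⊕ (Fin m → ℤ) → E := classFun A zE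
  let H : Subgroup (E ≃ₐ[ℚ] E) := MulAction.stabilizer (E ≃ₐ[ℚ] E) c
  -- the `G`-orbit of `c` consists of class functions of points of `R`, hence has `≤ N` elements
  have horb : ∀ x ∈ MulAction.orbit (E ≃ₐ[ℚ] E) c,
      ∃ i : Fin N, (fun w => ((x w : E) : ℂ)) = classFun A (pts i) := by
    rintro x ⟨σ, rfl⟩
    obtain ⟨i, t, hit⟩ := H2 (fun v => ((σ (zE v) : E) : ℂ)) (hconjR σ)
    refine ⟨i, ?_⟩
    have hx : (fun w => (((σ • c) w : E) : ℂ)) = classFun A (fun v => ((σ (zE v) : E) : ℂ)) := by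
      have h1 : σ • c = classFun A (fun v => σ (zE v)) := smul_classFun A E σ zE
      rw [h1]
      exact coe_classFun A E _
    rw [hx, show (fun v => ((σ (zE v) : E) : ℂ)) =
      fun v => ((∏ l, t l ^ A l v : ℂˣ) : ℂ) * pts i v from funext hit]
    exact classFun_torus A (pts i) t
  choose Ψ hΨ using horb
  have hcard : (MulAction.orbit (E ≃ₐ[ℚ] E) c).ncard ≤ N := by
    rw [← Nat.card_coe_set_eq]
    have hinj : Function.Injective (fun x : MulAction.orbit (E ≃ₐ[ℚ] E) c => Ψ x.1 x.2) := by
      intro x x' hxx'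
      apply Subtype.ext
      funext w
      have h1 := hΨ x.1 x.2
      have h2 := hΨ x'.1 x'.2
      simp only at hxx'
      rw [hxx', ← h2] at h1
      exact Subtype.ext (congrFun h1 w)
    simpa using Nat.card_le_card_of_injective _ hinj
  have hindex : H.index ≤ N := by
    rw [MulAction.index_stabilizer]
    exact hcard
  -- Step 3: the fixed field `K₀ = E^H`, of degree `[G:H] ≤ N` over `ℚ`
  let K₀ : IntermediateField ℚ E := IntermediateField.fixedField H
  have hK₀ : Module.finrank ℚ K₀ ≤ N := by
    have h1 : Module.finrank K₀ E = Nat.card H := IntermediateField.finrank_fixedField_eq_card H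
    have h2 : Nat.card (E ≃ₐ[ℚ] E) = Module.finrank ℚ E := IsGalois.card_aut_eq_finrank ℚ E
    have h3 := Module.finrank_mul_finrank ℚ K₀ E
    have h4 := H.card_mul_index
    have hH : 0 < Nat.card H := Nat.card_pos
    have : Module.finrank ℚ K₀ = H.index := by
      apply Nat.eq_of_mul_eq_mul_left hH
      calc Nat.card H * Module.finrank ℚ K₀ = Module.finrank ℚ K₀ * Module.finrank K₀ E := by
            rw [h1, mul_comm]
        _ = Nat.card H * H.index := by rw [h3, ← h2, h4]
    rw [this]
    exact hindex
  -- the kernel-lattice monomials of `z` lie in `K₀`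
  have hinvK₀ : ∀ u : Fin m → ℤ, (∀ v, z v = 0 → u v = 0) → (∀ l, ∑ v, A l v * u v = 0) →
      (∏ v, zE v ^ u v) ∈ K₀ := by
    intro u hu hA
    have hu' : ∀ v, zE v = 0 → u v = 0 := fun v hv => hu v ((hzE0 v).mp hv)
    rw [IntermediateField.mem_fixedField_iff]
    intro σ hσ
    have hσc : σ • c = c := MulAction.mem_stabilizer_iff.mp hσ
    have := congrFun hσc (Sum.inr u)
    rw [Pi.smul_apply, AlgEquiv.smul_def] at this
    rwa [show c (Sum.inr u) = ∏ v, zE v ^ u v from classFun_inr_of A zE hu' hA] at this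
  -- Step 4: descent of the orbit of `z` to `K₀` (on the support of `z`)
  let ι := {v : Fin m // z v ≠ 0}
  let K₁ : IntermediateField ℚ ℂ := IntermediateField.lift K₀
  have hmemK₁ : ∀ x : E, x ∈ K₀ → (x : ℂ) ∈ K₁ := fun x hx =>
    (IntermediateField.mem_lift x).mpr hx
  obtain ⟨y', t, hy'K, hy't⟩ := exists_point_over_of_invariants (ι := ι) (fun l i => A l i)
    K₁.toSubfield (fun i => Units.mk0 (z i) i.2) (by
      intro u' hu'
      -- extend `u'` by zero off the support of `z`
      let u : Fin m → ℤ := fun v => if h : z v ≠ 0 then u' ⟨v, h⟩ else 0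
      have hu0 : ∀ v, z v = 0 → u v = 0 := fun v hv => by simp [u, hv]
      have hsum : ∀ g : Fin m → ℤ, (∀ v, z v = 0 → g v = 0) →
          ∑ v, g v = ∑ i : ι, g i := by
        intro g hg
        calc ∑ v, g v = ∑ v ∈ univ.filter (fun v => z v ≠ 0), g v :=
              (Finset.sum_filter_of_ne (s := univ) (p := fun v => z v ≠ 0)
                (fun v _ hgv => fun hzv => hgv (hg v hzv))).symm
          _ = ∑ i : ι, g i := Finset.sum_subtype _ (fun v => by simp) g
      have hA : ∀ l, ∑ v, A l v * u v = 0 := by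
        intro l
        rw [hsum (fun v => A l v * u v) (fun v hv => by simp [hu0 v hv])]
        rw [← hu' l]
        exact sum_congr rfl fun i _ => by simp [u, i.2]
      have hprod : (((∏ i : ι, Units.mk0 (z i) i.2 ^ u' i : ℂˣ)) : ℂ) =
          (((∏ v, zE v ^ u v : E)) : ℂ) := by
        have hl : (((∏ i : ι, Units.mk0 (z i) i.2 ^ u' i : ℂˣ)) : ℂ) = ∏ i : ι, z i ^ u' i := by
          rw [Units.coe_prod]
          exact prod_congr rfl fun i _ => by rw [Units.val_zpow_eq_zpow_val, Units.val_mk0]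
        have hr : (((∏ v, zE v ^ u v : E)) : ℂ) = ∏ v, z v ^ u v := by
          change algebraMap E ℂ (∏ v, zE v ^ u v) = _
          rw [map_prod]
          exact prod_congr rfl fun v _ => by rw [map_zpow₀]; rfl
        rw [hl, hr]
        symm
        calc ∏ v, z v ^ u v = ∏ v ∈ univ.filter (fun v => z v ≠ 0), z v ^ u v := by
              refine (Finset.prod_filter_of_ne (s := univ) (p := fun v => z v ≠ 0)
                (fun v _ hv => fun hzv => hv ?_)).symm
              rw [hu0 v hzv, zpow_zero]
          _ = ∏ i : ι, z i ^ u i := Finset.prod_subtype _ (fun v => by simp) _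
          _ = ∏ i : ι, z i ^ u' i := prod_congr rfl fun i _ => by simp [u, i.2]
      rw [IntermediateField.mem_toSubfield, hprod]
      exact hmemK₁ _ (hinvK₀ u hu0 hA))
  -- Step 5: the point `y` (extend `y'` by zero) lies in the orbit of `z`, hence in `R`
  let y : Fin m → ℂ := fun v => if h : z v ≠ 0 then ((y' ⟨v, h⟩ : ℂˣ) : ℂ) else 0
  have hyz : ∀ v, y v = ((∏ l, t l ^ A l v : ℂˣ) : ℂ) * z v := by
    intro v
    by_cases h : z v ≠ 0
    · simp only [y, dif_pos h, hy't ⟨v, h⟩, Units.val_mul, Units.val_mk0]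
    · rw [not_not] at h
      simp [y, h]
  obtain ⟨i₀, t₀, hzt₀⟩ := H2 z hzR
  have hyR : ∀ f ∈ S, aeval y f = 0 := by
    intro f hf
    have hy : y = fun v => ((∏ l, (t l * t₀ l) ^ A l v : ℂˣ) : ℂ) * pts i₀ v := by
      funext v
      rw [hyz v, hzt₀ v, prod_mul_zpow_weights, Units.val_mul, mul_assoc]
    rw [hy]
    exact H1 i₀ (fun l => t l * t₀ l) f hf
  -- Step 6: conclusion
  refine ⟨K₁, y, ?_, ?_, ?_, hyR⟩
  · exact LinearEquiv.finiteDimensional (IntermediateField.liftAlgEquiv K₀).toLinearEquiv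
  · rw [← (IntermediateField.liftAlgEquiv K₀).toLinearEquiv.finrank_eq]
    exact hK₀
  · intro v
    by_cases h : z v ≠ 0
    · simp only [y, dif_pos h]
      exact hy'K ⟨v, h⟩
    · simp only [y, dif_neg h]
      exact K₁.zero_mem

end Summit.ValiantsHypothesis.ValiantsHypothesis.Theorems.GaugeDescent

end
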